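import Mathlib
import HarnessLib
import Summits.Ventures.LatticeQCDFlow.Scaling.TunnellingLaws
import Summits.Ventures.LatticeQCDFlow.Scaling.SpecialUnitaryLocalPaths

/-!
# LatticeQCDFlow / Scaling — the INTRINSIC small-step tunnelling law: sectors as connected components of the admissible region (v3.1, charge-free)

HONEST FRAMING: exact (Metropolis-corrected) sampling algorithms for lattice gauge theory; figures
of merit are autocorrelation/cost numbers at stated couplings and volumes; no continuum-physics
claim.

THEORY-2.md §3.3 (C2c-T) / conjecture C7(a), CHARGE-FREE FORM.  The metric laws of
`MetricTunnelling.lean` and `SpecialUnitaryLocalPaths.lean` (`SUN.small_step_tunnelling`, lean-1)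
bound the stationary probability that a fine-step exact sampler changes an integer CHARGE `Q`
continuous off a defect set `D` — for the geometric charge that continuity is Lüscher's sector
theorem, a cited hypothesis there.  The topological content needs no charge at all: call the
SECTOR of a configuration `x` the connected component `connectedComponentIn Dᶜ x` of the admissible
region `Dᶜ` containing it (Mathlib; `∅` for `x ∈ D`).  With local paths of radii `(ρ, r)`
(`dist x y ≤ ρ ⇒` a path from `x` to `y` inside the closed `r`-ball about `x`):

* `mem_connectedComponentIn_of_localPath` — a `ρ`-close pair whose first point is NOT within `r` of
  `D` lies in ONE sector (the local path is a preconnected subset of `Dᶜ`);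
* `mem_cthickening_of_sector_ne` — hence a `ρ`-small move that changes the sector starts in
  `cthickening r D`; `mem_cthickening_of_ne_of_sectorConstant` — the same for ANY function constant
  on sectors (this contains the continuous-charge separating lemmas);
* **`compProd_sector_ne_le_two_mul_cthickening`** — for every s-finite `μ`, every `μ`-invariant
  Markov kernel with a.s. `ρ`-small moves and EVERY set `D`:
  `(μ ⊗ₘ κ){sector ≠ sector'} ≤ 2·μ(cthickening r D)`; `…_add` (exceptional-set form, e.g. Gaussian
  momenta); `compProd_ne_le_two_mul_cthickening_of_sectorConstant` (any sector-constant `Q`);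
  **`measure_sector_ne_le_nsteps_cthickening`** — over `n` steps of a stationary chain the sector of
  `Z_n` differs from that of `Z_0` with probability `≤ n·2·m(cthickening r D)`;
* **`SUN.compProd_sector_ne_le`**, **`SUN.measure_sector_ne_le_nsteps`** — the `SU(N)^E` instances
  with CONSTANT ONE (`r = ρ ≤ r₀(N)`, from lean-1's single-radius local paths
  `SUN.exists_localPath_config`), for EVERY defect set `D` — in particular Lüscher's non-admissible
  set `{∃p, s_p ≥ ε_N}` [cite: Luscher1982Topology], whose complement's components ARE the lattice
  topological sectors; his theorem is needed only to LABEL components by an integer, not for the law.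
This is conjecture C7(a) in intrinsic form, PROVED with no hypothesis beyond invariance and small
steps.  (The `U(N)` instance, `r = 2ρ`, is a separate file.)  No sorry, no new axioms, no `def`.
-/

noncomputable section

open scoped Matrix.Norms.Frobenius ENNReal ProbabilityTheory
open MeasureTheory ProbabilityTheory Metric Set
namespace Summit.Ventures.LatticeQCDFlow.Theory2.Tunnelling

/-! ## §1. Sectors = connected components of `Dᶜ`; the separating lemma -/

section Separating

variable {X : Type*} [PseudoMetricSpace X]

/-- Along a path from `x` to `y`, continuous on `[0,1]` and inside the closed `r`-ball about `x`, with
`x ∉ cthickening r D`: `y` lies in the connected component of `Dᶜ` containing `x`. [folklore] -/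
theorem mem_connectedComponentIn_of_path {D : Set X} {x y : X} {r : ℝ} {γ : ℝ → X}
    (hγc : ContinuousOn γ (Icc (0 : ℝ) 1)) (hγ0 : γ 0 = x) (hγ1 : γ 1 = y)
    (hγd : ∀ t ∈ Icc (0 : ℝ) 1, dist (γ t) x ≤ r) (hx : x ∉ cthickening r D) :
    y ∈ connectedComponentIn Dᶜ x := by
  have hsub : γ '' Icc (0 : ℝ) 1 ⊆ Dᶜ := by
    rintro _ ⟨t, ht, rfl⟩ hD
    exact hx (mem_cthickening_of_dist_le x (γ t) r D hD (by rw [dist_comm]; exact hγd t ht))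
  have h := (isPreconnected_Icc.image γ hγc).subset_connectedComponentIn
    ⟨0, left_mem_Icc.2 zero_le_one, hγ0⟩ hsub
  exact h ⟨1, right_mem_Icc.2 zero_le_one, hγ1⟩

/-- With `(ρ, r)`-local paths: a `ρ`-close pair whose first point is not `r`-close to `D` lies in one
sector. [folklore] -/
theorem mem_connectedComponentIn_of_localPath {D : Set X} {ρ r : ℝ}
    (hpath : ∀ x y : X, dist x y ≤ ρ → ∃ γ : ℝ → X, ContinuousOn γ (Icc (0 : ℝ) 1) ∧ γ 0 = x ∧
      γ 1 = y ∧ ∀ t ∈ Icc (0 : ℝ) 1, dist (γ t) x ≤ r)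
    {x y : X} (hxy : dist x y ≤ ρ) (hx : x ∉ cthickening r D) : y ∈ connectedComponentIn Dᶜ x := by
  obtain ⟨γ, hγc, hγ0, hγ1, hγd⟩ := hpath x y hxy
  exact mem_connectedComponentIn_of_path hγc hγ0 hγ1 hγd hx

/-- **Separating lemma, intrinsic form.**  A `ρ`-small move that changes the SECTOR (the connected
component of `Dᶜ`) starts in `cthickening r D`. [folklore] -/
theorem mem_cthickening_of_sector_ne {D : Set X} {ρ r : ℝ}
    (hpath : ∀ x y : X, dist x y ≤ ρ → ∃ γ : ℝ → X, ContinuousOn γ (Icc (0 : ℝ) 1) ∧ γ 0 = x ∧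
      γ 1 = y ∧ ∀ t ∈ Icc (0 : ℝ) 1, dist (γ t) x ≤ r)
    {x y : X} (hxy : dist x y ≤ ρ) (hne : connectedComponentIn Dᶜ x ≠ connectedComponentIn Dᶜ y) :
    x ∈ cthickening r D := by
  by_contra hx
  exact hne (connectedComponentIn_eq (mem_connectedComponentIn_of_localPath hpath hxy hx))

/-- **Separating lemma for any sector-constant function** (`Q y = Q x` whenever `x ∉ D` and `y` is in
the sector of `x`; e.g. any charge continuous off `D` with discrete or integer values, or Lüscher's
geometric charge). [folklore] -/
theorem mem_cthickening_of_ne_of_sectorConstant {ι : Sort*} {D : Set X} {Q : X → ι}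
    (hQ : ∀ x, x ∉ D → ∀ y ∈ connectedComponentIn Dᶜ x, Q y = Q x) {ρ r : ℝ}
    (hpath : ∀ x y : X, dist x y ≤ ρ → ∃ γ : ℝ → X, ContinuousOn γ (Icc (0 : ℝ) 1) ∧ γ 0 = x ∧
      γ 1 = y ∧ ∀ t ∈ Icc (0 : ℝ) 1, dist (γ t) x ≤ r)
    {x y : X} (hxy : dist x y ≤ ρ) (hne : Q x ≠ Q y) : x ∈ cthickening r D := by
  by_contra hx
  have hxD : x ∉ D := fun h => hx (self_subset_cthickening D h)
  exact hne (hQ x hxD y (mem_connectedComponentIn_of_localPath hpath hxy hx)).symm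

end Separating

/-! ## §2. The intrinsic laws -/

section Laws

variable {X : Type*} [PseudoMetricSpace X] [MeasurableSpace X]

/-- **Intrinsic small-step tunnelling law.**  `(ρ, r)`-local paths, ANY set `D`, `μ` s-finite, `κ` a
`μ`-invariant Markov kernel with a.s. `ρ`-small moves:
`(μ ⊗ₘ κ){sector ≠ sector'} ≤ 2·μ(cthickening r D)`. [folklore] -/
theorem compProd_sector_ne_le_two_mul_cthickening {D : Set X} {ρ r : ℝ}
    (hpath : ∀ x y : X, dist x y ≤ ρ → ∃ γ : ℝ → X, ContinuousOn γ (Icc (0 : ℝ) 1) ∧ γ 0 = x ∧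
      γ 1 = y ∧ ∀ t ∈ Icc (0 : ℝ) 1, dist (γ t) x ≤ r)
    (μ : Measure X) [SFinite μ] (κ : Kernel X X) [IsMarkovKernel κ] (hinv : κ.Invariant μ)
    (hstep : ∀ᵐ p ∂(μ ⊗ₘ κ), dist p.1 p.2 ≤ ρ) :
    (μ ⊗ₘ κ) {p | connectedComponentIn Dᶜ p.1 ≠ connectedComponentIn Dᶜ p.2} ≤
      2 * μ (cthickening r D) :=
  compProd_chargeChange_le_of_invariant (R := fun x y => dist x y ≤ ρ)
    (Q := fun x => connectedComponentIn Dᶜ x)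
    (fun _ _ hxy hne => Or.inl (mem_cthickening_of_sector_ne hpath hxy hne)) μ κ hinv hstep

/-- **Intrinsic law with an exceptional set** (no a.s. step hypothesis):
`(μ ⊗ₘ κ){sector ≠ sector'} ≤ 2·μ(cthickening r D) + (μ ⊗ₘ κ){dist > ρ}`. [folklore] -/
theorem compProd_sector_ne_le_two_mul_cthickening_add {D : Set X} {ρ r : ℝ}
    (hpath : ∀ x y : X, dist x y ≤ ρ → ∃ γ : ℝ → X, ContinuousOn γ (Icc (0 : ℝ) 1) ∧ γ 0 = x ∧
      γ 1 = y ∧ ∀ t ∈ Icc (0 : ℝ) 1, dist (γ t) x ≤ r)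
    (μ : Measure X) [SFinite μ] (κ : Kernel X X) [IsMarkovKernel κ] (hinv : κ.Invariant μ) :
    (μ ⊗ₘ κ) {p | connectedComponentIn Dᶜ p.1 ≠ connectedComponentIn Dᶜ p.2} ≤
      2 * μ (cthickening r D) + (μ ⊗ₘ κ) {p | ¬ dist p.1 p.2 ≤ ρ} :=
  compProd_chargeChange_le_add_of_invariant (R := fun x y => dist x y ≤ ρ)
    (Q := fun x => connectedComponentIn Dᶜ x)
    (fun _ _ hxy hne => Or.inl (mem_cthickening_of_sector_ne hpath hxy hne)) μ κ hinv

/-- **Law for any sector-constant function** (contains the continuous-charge laws). [folklore] -/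
theorem compProd_ne_le_two_mul_cthickening_of_sectorConstant {ι : Type*} {D : Set X} {Q : X → ι}
    (hQ : ∀ x, x ∉ D → ∀ y ∈ connectedComponentIn Dᶜ x, Q y = Q x) {ρ r : ℝ}
    (hpath : ∀ x y : X, dist x y ≤ ρ → ∃ γ : ℝ → X, ContinuousOn γ (Icc (0 : ℝ) 1) ∧ γ 0 = x ∧
      γ 1 = y ∧ ∀ t ∈ Icc (0 : ℝ) 1, dist (γ t) x ≤ r)
    (μ : Measure X) [SFinite μ] (κ : Kernel X X) [IsMarkovKernel κ] (hinv : κ.Invariant μ)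
    (hstep : ∀ᵐ p ∂(μ ⊗ₘ κ), dist p.1 p.2 ≤ ρ) :
    (μ ⊗ₘ κ) {p | Q p.1 ≠ Q p.2} ≤ 2 * μ (cthickening r D) :=
  compProd_chargeChange_le_of_invariant (R := fun x y => dist x y ≤ ρ)
    (fun _ _ hxy hne => Or.inl (mem_cthickening_of_ne_of_sectorConstant hQ hpath hxy hne))
    μ κ hinv hstep

/-- **`n`-step sector persistence.**  For a process `Z` with all one-time marginals `m` and a.s.
`ρ`-small steps (e.g. a stationary fine-step exact sampler), the sector of `Z n` differs from that of
`Z 0` with probability `≤ n·2·m(cthickening r D)`. [folklore] -/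
theorem measure_sector_ne_le_nsteps_cthickening {D : Set X} {ρ r : ℝ}
    (hpath : ∀ x y : X, dist x y ≤ ρ → ∃ γ : ℝ → X, ContinuousOn γ (Icc (0 : ℝ) 1) ∧ γ 0 = x ∧
      γ 1 = y ∧ ∀ t ∈ Icc (0 : ℝ) 1, dist (γ t) x ≤ r)
    {Ω : Type*} [MeasurableSpace Ω] (P : Measure Ω) (Z : ℕ → Ω → X) (hZ : ∀ k, Measurable (Z k))
    (m : Measure X) (hmarg : ∀ k, P.map (Z k) = m)
    (hstep : ∀ k, ∀ᵐ ω ∂P, dist (Z k ω) (Z (k + 1) ω) ≤ ρ) (n : ℕ) :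
    P {ω | connectedComponentIn Dᶜ (Z n ω) ≠ connectedComponentIn Dᶜ (Z 0 ω)} ≤
      n * (2 * m (cthickening r D)) := by
  refine measure_chargeChange_le_nsteps (R := fun _ x y => dist x y ≤ ρ)
    (Q := fun x => connectedComponentIn Dᶜ x) (B := fun _ => cthickening r D)
    (fun _ _ _ hxy hne => Or.inl (mem_cthickening_of_sector_ne hpath hxy hne)) P Z hstep
    (fun k => ?_) n
  have h1 : ∀ j, P (Z j ⁻¹' cthickening r D) ≤ m (cthickening r D) := fun j => by
    rw [← hmarg j]; exact Measure.le_map_apply (hZ j).aemeasurable _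
  calc P (Z k ⁻¹' cthickening r D) + P (Z (k + 1) ⁻¹' cthickening r D)
      ≤ m (cthickening r D) + m (cthickening r D) := add_le_add (h1 k) (h1 (k + 1))
    _ = 2 * m (cthickening r D) := (two_mul _).symm

end Laws

end Summit.Ventures.LatticeQCDFlow.Theory2.Tunnelling

/-! ## §3. The `SU(N)^E` instance at constant one (every defect set; no charge, no sector theorem needed) -/

namespace Summit.Ventures.LatticeQCDFlow.Theory2.Lattice.SUN

open Summit.Ventures.LatticeQCDFlow.Theory2.Tunnelling

variable {N : ℕ}

/-- `(ρ, ρ)`-local paths on `SU(N)^E` for every `ρ ≤ r₀(N)`, from lean-1's single-radius local paths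
`exists_localPath_config`. [folklore] -/
theorem exists_localPaths_config {E : Type*} [Fintype E] : ∃ r₀ : ℝ, 0 < r₀ ∧ ∀ ρ : ℝ, ρ ≤ r₀ →
    ∀ U V : E → Matrix.specialUnitaryGroup (Fin N) ℂ, dist U V ≤ ρ →
      ∃ γ : ℝ → (E → Matrix.specialUnitaryGroup (Fin N) ℂ), ContinuousOn γ (Icc (0 : ℝ) 1) ∧ γ 0 = U ∧
        γ 1 = V ∧ ∀ t ∈ Icc (0 : ℝ) 1, dist (γ t) U ≤ ρ := by
  obtain ⟨r₀, hr₀, hpath⟩ := exists_localPath_config (N := N) (E := E)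
  refine ⟨r₀, hr₀, fun ρ hρ U V hUV => ?_⟩
  obtain ⟨γ, hγc, hγ0, hγ1, hγd⟩ := hpath U V (hUV.trans hρ)
  exact ⟨γ, hγc, hγ0, hγ1, fun t ht => (hγd t ht).trans hUV⟩

/-- **`SU(N)` intrinsic small-step tunnelling law, constant one.**  There is `r₀ > 0` (depending on
`N` only; no dependence on the volume or `β`) such that for all `ρ ≤ r₀`, EVERY set `D ⊆ SU(N)^E`,
every s-finite `m` and every `m`-invariant Markov kernel with a.s. `ρ`-small moves (sup–Hilbert–Schmidt
metric): the sector — the connected component of `Dᶜ` — changes with stationary one-step probability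
`≤ 2·m(cthickening ρ D)`.  With `D` the non-admissible set `{∃p, s_p ≥ ε_N}` these components are the
lattice topological sectors [cite: Luscher1982Topology]. [folklore] -/
theorem compProd_sector_ne_le {E : Type*} [Fintype E] : ∃ r₀ : ℝ, 0 < r₀ ∧ ∀ ρ : ℝ, ρ ≤ r₀ →
    ∀ (D : Set (E → Matrix.specialUnitaryGroup (Fin N) ℂ))
      (m : Measure (E → Matrix.specialUnitaryGroup (Fin N) ℂ)) [SFinite m]
      (κ : Kernel (E → Matrix.specialUnitaryGroup (Fin N) ℂ) (E → Matrix.specialUnitaryGroup (Fin N) ℂ))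
      [IsMarkovKernel κ], κ.Invariant m → (∀ᵐ q ∂(m ⊗ₘ κ), dist q.1 q.2 ≤ ρ) →
        (m ⊗ₘ κ) {q | connectedComponentIn Dᶜ q.1 ≠ connectedComponentIn Dᶜ q.2} ≤
          2 * m (cthickening ρ D) := by
  obtain ⟨r₀, hr₀, hpath⟩ := exists_localPaths_config (N := N) (E := E)
  refine ⟨r₀, hr₀, fun ρ hρ D m _ κ _ hinv hstep => ?_⟩
  exact compProd_sector_ne_le_two_mul_cthickening (hpath ρ hρ) m κ hinv hstep

/-- **`SU(N)` intrinsic law with an exceptional set** (moves longer than `ρ` allowed on a set whose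
`m ⊗ₘ κ`-mass is added; e.g. fine-step HMC with Gaussian momenta). [folklore] -/
theorem compProd_sector_ne_le_add {E : Type*} [Fintype E] : ∃ r₀ : ℝ, 0 < r₀ ∧ ∀ ρ : ℝ, ρ ≤ r₀ →
    ∀ (D : Set (E → Matrix.specialUnitaryGroup (Fin N) ℂ))
      (m : Measure (E → Matrix.specialUnitaryGroup (Fin N) ℂ)) [SFinite m]
      (κ : Kernel (E → Matrix.specialUnitaryGroup (Fin N) ℂ) (E → Matrix.specialUnitaryGroup (Fin N) ℂ))
      [IsMarkovKernel κ], κ.Invariant m →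
        (m ⊗ₘ κ) {q | connectedComponentIn Dᶜ q.1 ≠ connectedComponentIn Dᶜ q.2} ≤
          2 * m (cthickening ρ D) + (m ⊗ₘ κ) {q | ¬ dist q.1 q.2 ≤ ρ} := by
  obtain ⟨r₀, hr₀, hpath⟩ := exists_localPaths_config (N := N) (E := E)
  refine ⟨r₀, hr₀, fun ρ hρ D m _ κ _ hinv => ?_⟩
  exact compProd_sector_ne_le_two_mul_cthickening_add (hpath ρ hρ) m κ hinv

/-- **`SU(N)` `n`-step sector persistence**: for a process on `SU(N)^E` with one-time marginals `m`
and a.s. steps `≤ ρ ≤ r₀`, `P{sector(Z n) ≠ sector(Z 0)} ≤ n·2·m(cthickening ρ D)`. [folklore] -/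
theorem measure_sector_ne_le_nsteps {E : Type*} [Fintype E] : ∃ r₀ : ℝ, 0 < r₀ ∧ ∀ ρ : ℝ, ρ ≤ r₀ →
    ∀ (D : Set (E → Matrix.specialUnitaryGroup (Fin N) ℂ)) {Ω : Type*} [MeasurableSpace Ω]
      (P : Measure Ω) (Z : ℕ → Ω → (E → Matrix.specialUnitaryGroup (Fin N) ℂ)),
      (∀ k, Measurable (Z k)) → ∀ m : Measure (E → Matrix.specialUnitaryGroup (Fin N) ℂ),
        (∀ k, P.map (Z k) = m) → (∀ k, ∀ᵐ ω ∂P, dist (Z k ω) (Z (k + 1) ω) ≤ ρ) → ∀ n : ℕ,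
          P {ω | connectedComponentIn Dᶜ (Z n ω) ≠ connectedComponentIn Dᶜ (Z 0 ω)} ≤
            n * (2 * m (cthickening ρ D)) := by
  obtain ⟨r₀, hr₀, hpath⟩ := exists_localPaths_config (N := N) (E := E)
  refine ⟨r₀, hr₀, fun ρ hρ D Ω _ P Z hZ m hmarg hstep n => ?_⟩
  exact measure_sector_ne_le_nsteps_cthickening (hpath ρ hρ) P Z hZ m hmarg hstep n

end Summit.Ventures.LatticeQCDFlow.Theory2.Lattice.SUN
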